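import Summits.HodgeConjecture.HodgeConjecture.Theorems.F0P6aStubE6Organ   -- ★ PART A of the same Lines workfile (size-lint split; same namespace `Summit.HodgeConjecture.HodgeConjecture.Cruxes.HLiu418.F0P6aStubE6`)
import HarnessLib

/-!
# ★ RE-HOME — PART C of 3 (size lint: `Theorems/` files with proofs are ≤ 400 lines) of `Lines/F0_P6a_StubE6.lean`: Part A = `Theorems/F0P6aStubE6Sockets.lean`, Part B = `Theorems/F0P6aStubE6Organ.lean` (imported), this = §1–§4 (the heads, `stub_E6_of_line` last).

Same namespace `Summit.HodgeConjecture.HodgeConjecture.Cruxes.HLiu418.F0P6aStubE6` (every fully-qualified name unchanged); the preamble (options, `noncomputable section`, top-level `open`s) is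
repeated verbatim from Part A∕B; the code below is the remainder of the tree bytes, untouched.  See Part A for the ★ re-home header and the original module
docstring.  HC_CM is proved only modulo the 7 printed citations (2 remaining: hLiu418 = stmt-HodgeConjecture-24832, h413 = stmt-HodgeConjecture-24833) until rung 0 closes.
-/


set_option autoImplicit false

noncomputable section

namespace Summit.HodgeConjecture.HodgeConjecture.Cruxes.HLiu418.F0P6aStubE6

set_option linter.dupNamespace false

open CategoryTheory CategoryTheory.Limits NumberField IsDedekindDomain MulAction Matrix AlgebraicGeometry
open scoped Matrix ComplexOrder Polynomial MonObj
open Literature.AlgebraicGeometry.Motives (SchemeOver AlgPoints ComplexPoints specOver)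
open Literature.AlgebraicGeometry.Motives.AbelianVariety (bcSpec)
open Literature.AlgebraicGeometry.Motives.GaloisDescent (gal bc gal_fst)
open Literature.AlgebraicGeometry.AbelianSchemes (PolarizedAbelianSchemeWithLevel AbelianSchemeOver)
open Literature.AlgebraicGeometry.ModuliOfAbelianVarieties
open Literature.AlgebraicGeometry.ShimuraVarieties Literature.AlgebraicGeometry.ShimuraVarieties.UnitaryCanonicalModel
open Literature.NumberTheory.Automorphic Literature.NumberTheory.Automorphic.UnitaryGroup
open Literature.NumberTheory.Automorphic.Liu2021.AppendixC (C5.OpenCompactSubgroup C5.SmallLevel)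
open Literature.Geometry.Kaehler (ComplexTorus)
open Summit.HodgeConjecture.HodgeConjecture.Cruxes.HLiu418.F0P6aPELWitnessE (GSAdele IsCMTypeThrough mOf AuxChartGS)
open Summit.HodgeConjecture.HodgeConjecture.Cruxes.HLiu418.F0P6aSigmaGAL (ReadsCGalois ReadsCReading sigmaGAL_of_stub)

/-! ## §1 The assembly: `stub_E6` from σ1 + σR + σK at the canonical pull-back -/

/-- **`stub_E6` FROM THE SOCKETS**: if for every letter context the canonical pull-back `P := univ.baseChange (ε ≫ pr)` carries an `𝒪_F`-action `ρ`
with the admissible-marking READING (σ1), the ROSATI identities (σR) and the KOTTWITZ charpoly at complex points (σK), then `stub_E6` holds — with the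
tuple related to `univ` by ★ `baseChange_isBaseChangeVia`.  Sorry-free; the sockets are hypotheses. [cite: Kottwitz1992, §5 (pp. 389–391)]
[cite: RapoportSmithlingZhang2020Diagonal, §4.1 p. 17] -/
theorem stub_E6_of
    (h : ∀ (F : Type) [Field F] [NumberField F] [IsCMField F] [IsGalois ℚ F] (ι₁ : F →+* ℂ)
      (Jstar : Matrix (Fin 2) (Fin 2) F) (_hJ : (Jstar.map (IsCMField.complexConj F))ᵀ = Jstar) (_hJu : IsUnit Jstar)
      (K₀ : C5.OpenCompactSubgroup (GSAdele F Jstar)) (S : RecordSystemGS F Jstar ι₁ K₀) (Kc : C5.SmallLevel K₀)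
      (Fi : Type) [Field Fi] [NumberField Fi] [Algebra F Fi] [IsGalois F Fi] (τE : Fi →+* ℂ) (_hτE : τE.comp (algebraMap F Fi) = ι₁)
      (Φ : Set (F →+* ℂ)) (_hΦ : IsCMTypeThrough ι₁ Φ) (C : AuxChartGS F ι₁ Jstar K₀ S Kc Fi τE Φ)
      (ε : (Literature.AlgebraicGeometry.Motives.baseChange F Fi).obj (S.M.obj Kc) ⟶
          (Literature.AlgebraicGeometry.Motives.baseChange ℚ Fi).obj C.𝓜.M)
      (_hε : letI : Algebra Fi ℂ := τE.toAlgebra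
        ∀ (P : ComplexPoints ((Literature.AlgebraicGeometry.Motives.baseChange F Fi).obj (S.M.obj Kc)))
          (Pflat : letI : Algebra F ℂ := ι₁.toAlgebra; ComplexPoints (S.M.obj Kc)),
          Pflat.left = P.left ≫ pullback.fst (S.M.obj Kc).hom (bcSpec F Fi) →
          (AlgPoints.map ε P).left ≫ pullback.fst C.𝓜.M.hom (bcSpec ℚ Fi) =
            (letI : Algebra F ℂ := ι₁.toAlgebra; (C.f (S.pts Kc Pflat)).left))
      (_hU : Literature.AlgebraicGeometry.ModuliOfAbelianVarieties.siegelUniversalFamilyUniformisation),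
      ∃ ρ : AbelianSchemeOver.RingAction (𝓞 F) (C.𝓜.univ.baseChange (ε.left ≫ pullback.fst C.𝓜.M.hom (bcSpec ℚ Fi))).A,
        RingActionReading C ε ρ ∧ RosatiOver C ε ρ ∧ KottwitzOver C ε ρ) :
    StubE6 := by
  intro F _ _ _ _ ι₁ Jstar hJ hJu K₀ S Kc Fi _ _ _ _ τE hτE Φ hΦ C ε hε hU
  obtain ⟨ρ, -, hR, hK⟩ := h F ι₁ Jstar hJ hJu K₀ S Kc Fi τE hτE Φ hΦ C ε hε hU
  exact ⟨C.𝓜.univ.baseChange (ε.left ≫ pullback.fst C.𝓜.M.hom (bcSpec ℚ Fi)), _, _,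
    C.𝓜.univ.baseChange_isBaseChangeVia _, ρ, hR, hK⟩

/-- **`stub_E6` FROM σ1 + σR ONLY** (σK discharged by `kottwitzOver_of_reading`): an `𝒪_F`-action on the canonical pull-back with the
admissible-marking READING and the ROSATI identities gives `stub_E6`.  Sorry-free. [cite: Kottwitz1992, §5 (pp. 389–391)]
[cite: RapoportSmithlingZhang2020Diagonal, §4.1 p. 17] -/
theorem stub_E6_of_reading_rosati
    (h : ∀ (F : Type) [Field F] [NumberField F] [IsCMField F] [IsGalois ℚ F] (ι₁ : F →+* ℂ)
      (Jstar : Matrix (Fin 2) (Fin 2) F) (_hJ : (Jstar.map (IsCMField.complexConj F))ᵀ = Jstar) (_hJu : IsUnit Jstar)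
      (K₀ : C5.OpenCompactSubgroup (GSAdele F Jstar)) (S : RecordSystemGS F Jstar ι₁ K₀) (Kc : C5.SmallLevel K₀)
      (Fi : Type) [Field Fi] [NumberField Fi] [Algebra F Fi] [IsGalois F Fi] (τE : Fi →+* ℂ) (_hτE : τE.comp (algebraMap F Fi) = ι₁)
      (Φ : Set (F →+* ℂ)) (_hΦ : IsCMTypeThrough ι₁ Φ) (C : AuxChartGS F ι₁ Jstar K₀ S Kc Fi τE Φ)
      (ε : (Literature.AlgebraicGeometry.Motives.baseChange F Fi).obj (S.M.obj Kc) ⟶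
          (Literature.AlgebraicGeometry.Motives.baseChange ℚ Fi).obj C.𝓜.M)
      (_hε : letI : Algebra Fi ℂ := τE.toAlgebra
        ∀ (P : ComplexPoints ((Literature.AlgebraicGeometry.Motives.baseChange F Fi).obj (S.M.obj Kc)))
          (Pflat : letI : Algebra F ℂ := ι₁.toAlgebra; ComplexPoints (S.M.obj Kc)),
          Pflat.left = P.left ≫ pullback.fst (S.M.obj Kc).hom (bcSpec F Fi) →
          (AlgPoints.map ε P).left ≫ pullback.fst C.𝓜.M.hom (bcSpec ℚ Fi) =
            (letI : Algebra F ℂ := ι₁.toAlgebra; (C.f (S.pts Kc Pflat)).left))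
      (_hU : Literature.AlgebraicGeometry.ModuliOfAbelianVarieties.siegelUniversalFamilyUniformisation),
      ∃ ρ : AbelianSchemeOver.RingAction (𝓞 F) (C.𝓜.univ.baseChange (ε.left ≫ pullback.fst C.𝓜.M.hom (bcSpec ℚ Fi))).A,
        RingActionReading C ε ρ ∧ RosatiOver C ε ρ) :
    StubE6 :=
  stub_E6_of fun F _ _ _ _ ι₁ Jstar hJ hJu K₀ S Kc Fi _ _ _ _ τE hτE Φ hΦ C ε hε hU => by
    obtain ⟨ρ, hRd, hR⟩ := h F ι₁ Jstar hJ hJu K₀ S Kc Fi τE hτE Φ hΦ C ε hε hU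
    exact ⟨ρ, hRd, hR, kottwitzOver_of_reading hτE C ε ρ hRd⟩

/-- **`stub_E6` FROM Σ-ℂ + σR** (D2 + D1 + σK): the analytic organ՚s Galois-equivariant READ family over `X_ℂ` and the ROSATI identities
for the resulting action give `stub_E6`.  SORRY-FREE (D1, D2, σK proved; the sockets Σ-ℂ and σR are hypotheses). [cite: Kottwitz1992, §5 (pp. 389–391)]
[cite: Milne2005ShimuraVarieties, §13 Prop. 13.1 p. 117] -/
theorem stub_E6_of_readsC_rosati
    (h : ∀ (F : Type) [Field F] [NumberField F] [IsCMField F] [IsGalois ℚ F] (ι₁ : F →+* ℂ)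
      (Jstar : Matrix (Fin 2) (Fin 2) F) (_hJ : (Jstar.map (IsCMField.complexConj F))ᵀ = Jstar) (_hJu : IsUnit Jstar)
      (K₀ : C5.OpenCompactSubgroup (GSAdele F Jstar)) (S : RecordSystemGS F Jstar ι₁ K₀) (Kc : C5.SmallLevel K₀)
      (Fi : Type) [Field Fi] [NumberField Fi] [Algebra F Fi] [IsGalois F Fi] (τE : Fi →+* ℂ) (_hτE : τE.comp (algebraMap F Fi) = ι₁)
      (Φ : Set (F →+* ℂ)) (_hΦ : IsCMTypeThrough ι₁ Φ) (C : AuxChartGS F ι₁ Jstar K₀ S Kc Fi τE Φ)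
      (ε : (Literature.AlgebraicGeometry.Motives.baseChange F Fi).obj (S.M.obj Kc) ⟶
          (Literature.AlgebraicGeometry.Motives.baseChange ℚ Fi).obj C.𝓜.M)
      (_hε : letI : Algebra Fi ℂ := τE.toAlgebra
        ∀ (P : ComplexPoints ((Literature.AlgebraicGeometry.Motives.baseChange F Fi).obj (S.M.obj Kc)))
          (Pflat : letI : Algebra F ℂ := ι₁.toAlgebra; ComplexPoints (S.M.obj Kc)),
          Pflat.left = P.left ≫ pullback.fst (S.M.obj Kc).hom (bcSpec F Fi) →
          (AlgPoints.map ε P).left ≫ pullback.fst C.𝓜.M.hom (bcSpec ℚ Fi) =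
            (letI : Algebra F ℂ := ι₁.toAlgebra; (C.f (S.pts Kc Pflat)).left))
      (_hU : Literature.AlgebraicGeometry.ModuliOfAbelianVarieties.siegelUniversalFamilyUniformisation),
      (∃ Y hY, ReadsC C ε Y hY) ∧
      ∀ ρ : AbelianSchemeOver.RingAction (𝓞 F) (C.𝓜.univ.baseChange (ε.left ≫ pullback.fst C.𝓜.M.hom (bcSpec ℚ Fi))).A,
        RingActionReading C ε ρ → RosatiOver C ε ρ) :
    StubE6 :=
  stub_E6_of_reading_rosati fun F _ _ _ _ ι₁ Jstar hJ hJu K₀ S Kc Fi _ _ _ _ τE hτE Φ hΦ C ε hε hU => by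
    obtain ⟨⟨Y, hY, hC⟩, hRos⟩ := h F ι₁ Jstar hJ hJu K₀ S Kc Fi τE hτE Φ hΦ C ε hε hU
    obtain ⟨i, hi, hR⟩ := exists_reads_of_readsC hτE C ε Y hY hC
    obtain ⟨ρ, hρ⟩ := exists_ringActionReading_of_reads hτE C ε i hi hR
    exact ⟨ρ, hρ, hRos ρ hρ⟩

/-! ## §2 (v6, A-p06 (g33)) σR DISCHARGED BY NAME (★ E6-R `F0P6aRosatiOverOfReading` p847226) AND THE Σ-ℂ SPLIT Σ-AN ∕ Σ-GAL -/

section SigmaR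

variable {F : Type} [Field F] [NumberField F] [IsCMField F] {ι₁ : F →+* ℂ} {Jstar : Matrix (Fin 2) (Fin 2) F}
  {K₀ : C5.OpenCompactSubgroup (GSAdele F Jstar)} {S : RecordSystemGS F Jstar ι₁ K₀} {Kc : C5.SmallLevel K₀}
  {Fi : Type} [Field Fi] [NumberField Fi] [Algebra F Fi] {τE : Fi →+* ℂ} {Φ : Set (F →+* ℂ)}

/-- **σR ⇐ σ1 AT THE CANONICAL PULL-BACK, BY NAME** — one term over ★ `Theorems.F0P6aRosatiOverOfReading.rosatiOver_of_reads` (A-p04 (g23),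
cert `CERT-E6Closer.v5.plusSigmaR` bbef75f9): the Rosati identities over `X` for any `𝒪_F`-action that READS through the admissible markings
(`Mρ_linear` = the first conjunct of (F2) `C.Mρ_kottwitz`, `Mρ_rosati` = the chart field). [cite: Kottwitz1992, §5 (p. 390)] -/
theorem rosatiOver_of_ringActionReading (hτE : τE.comp (algebraMap F Fi) = ι₁) (C : AuxChartGS F ι₁ Jstar K₀ S Kc Fi τE Φ)
    (ε : (Literature.AlgebraicGeometry.Motives.baseChange F Fi).obj (S.M.obj Kc) ⟶
        (Literature.AlgebraicGeometry.Motives.baseChange ℚ Fi).obj C.𝓜.M)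
    (ρ : AbelianSchemeOver.RingAction (𝓞 F)
        (C.𝓜.univ.baseChange (ε.left ≫ pullback.fst C.𝓜.M.hom (bcSpec ℚ Fi))).A)
    (hR : RingActionReading C ε ρ) : RosatiOver C ε ρ :=
  Summit.HodgeConjecture.HodgeConjecture.Theorems.F0P6aRosatiOverOfReading.rosatiOver_of_reads hτE C.hg C.hδ C.hN C.𝓜 C.piece C.Z
    C.Z_mem C.Mρ (fun a v hv b => (C.Mρ_kottwitz a v hv b).imp fun _ h => h.1) C.Mρ_rosati ε ρ hR

end SigmaR

/-- **`stub_E6` FROM Σ-ℂ ALONE** (v6: σR discharged by ★ E6-R, D1∕D2∕σK as in v5): a Galois-equivariant READ family over `X_ℂ` gives `stub_E6`.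
SORRY-FREE; the one hypothesis is the analytic organ Σ-ℂ `∃ Y hY, ReadsC C ε Y hY`. [cite: Kottwitz1992, §5 (pp. 389–391)]
[cite: Milne2005ShimuraVarieties, §13 Prop. 13.1 p. 117] -/
theorem stub_E6_of_readsC
    (h : ∀ (F : Type) [Field F] [NumberField F] [IsCMField F] [IsGalois ℚ F] (ι₁ : F →+* ℂ)
      (Jstar : Matrix (Fin 2) (Fin 2) F) (_hJ : (Jstar.map (IsCMField.complexConj F))ᵀ = Jstar) (_hJu : IsUnit Jstar)
      (K₀ : C5.OpenCompactSubgroup (GSAdele F Jstar)) (S : RecordSystemGS F Jstar ι₁ K₀) (Kc : C5.SmallLevel K₀)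
      (Fi : Type) [Field Fi] [NumberField Fi] [Algebra F Fi] [IsGalois F Fi] (τE : Fi →+* ℂ) (_hτE : τE.comp (algebraMap F Fi) = ι₁)
      (Φ : Set (F →+* ℂ)) (_hΦ : IsCMTypeThrough ι₁ Φ) (C : AuxChartGS F ι₁ Jstar K₀ S Kc Fi τE Φ)
      (ε : (Literature.AlgebraicGeometry.Motives.baseChange F Fi).obj (S.M.obj Kc) ⟶
          (Literature.AlgebraicGeometry.Motives.baseChange ℚ Fi).obj C.𝓜.M)
      (_hε : letI : Algebra Fi ℂ := τE.toAlgebra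
        ∀ (P : ComplexPoints ((Literature.AlgebraicGeometry.Motives.baseChange F Fi).obj (S.M.obj Kc)))
          (Pflat : letI : Algebra F ℂ := ι₁.toAlgebra; ComplexPoints (S.M.obj Kc)),
          Pflat.left = P.left ≫ pullback.fst (S.M.obj Kc).hom (bcSpec F Fi) →
          (AlgPoints.map ε P).left ≫ pullback.fst C.𝓜.M.hom (bcSpec ℚ Fi) =
            (letI : Algebra F ℂ := ι₁.toAlgebra; (C.f (S.pts Kc Pflat)).left))
      (_hU : Literature.AlgebraicGeometry.ModuliOfAbelianVarieties.siegelUniversalFamilyUniformisation),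
      ∃ Y hY, ReadsC C ε Y hY) :
    StubE6 :=
  stub_E6_of_readsC_rosati fun F _ _ _ _ ι₁ Jstar hJ hJu K₀ S Kc Fi _ _ _ _ τE hτE Φ hΦ C ε hε hU =>
    ⟨h F ι₁ Jstar hJ hJu K₀ S Kc Fi τE hτE Φ hΦ C ε hε hU, fun ρ hρ => rosatiOver_of_ringActionReading hτE C ε ρ hρ⟩

/-- **`stub_E6` FROM THE TWO Σ-SOCKETS Σ-AN + Σ-GAL** (v6): (Σ-AN) a family `Y` over `X_ℂ` that READS as `Mρ a b` through the admissible markings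
at every complex point (analytic hand: ★ P-3 + ★ E6-lin + `Z_equivariant` + ★ MRK-TRANSPORT + ★ E6-an′ p847428), and (Σ-GAL) «every READ family
is Galois-equivariant» (E6-γ hand: rigidity ★ B-γ + CM points) give `stub_E6`.  SORRY-FREE composition; both sockets by value
(`ReadsCReading`, `ReadsCGalois`). [cite: Kottwitz1992, §5 (pp. 389–391)] [cite: Milne2005ShimuraVarieties, §13 Prop. 13.1 p. 117]
[cite: Lange2023AbelianVarietiesComplex, §3.4 Proposition 3.4.1] -/
theorem stub_E6_of_sigmaAN_sigmaGAL
    (h : ∀ (F : Type) [Field F] [NumberField F] [IsCMField F] [IsGalois ℚ F] (ι₁ : F →+* ℂ)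
      (Jstar : Matrix (Fin 2) (Fin 2) F) (_hJ : (Jstar.map (IsCMField.complexConj F))ᵀ = Jstar) (_hJu : IsUnit Jstar)
      (K₀ : C5.OpenCompactSubgroup (GSAdele F Jstar)) (S : RecordSystemGS F Jstar ι₁ K₀) (Kc : C5.SmallLevel K₀)
      (Fi : Type) [Field Fi] [NumberField Fi] [Algebra F Fi] [IsGalois F Fi] (τE : Fi →+* ℂ) (_hτE : τE.comp (algebraMap F Fi) = ι₁)
      (Φ : Set (F →+* ℂ)) (_hΦ : IsCMTypeThrough ι₁ Φ) (C : AuxChartGS F ι₁ Jstar K₀ S Kc Fi τE Φ)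
      (ε : (Literature.AlgebraicGeometry.Motives.baseChange F Fi).obj (S.M.obj Kc) ⟶
          (Literature.AlgebraicGeometry.Motives.baseChange ℚ Fi).obj C.𝓜.M)
      (_hε : letI : Algebra Fi ℂ := τE.toAlgebra
        ∀ (P : ComplexPoints ((Literature.AlgebraicGeometry.Motives.baseChange F Fi).obj (S.M.obj Kc)))
          (Pflat : letI : Algebra F ℂ := ι₁.toAlgebra; ComplexPoints (S.M.obj Kc)),
          Pflat.left = P.left ≫ pullback.fst (S.M.obj Kc).hom (bcSpec F Fi) →
          (AlgPoints.map ε P).left ≫ pullback.fst C.𝓜.M.hom (bcSpec ℚ Fi) =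
            (letI : Algebra F ℂ := ι₁.toAlgebra; (C.f (S.pts Kc Pflat)).left))
      (_hU : Literature.AlgebraicGeometry.ModuliOfAbelianVarieties.siegelUniversalFamilyUniformisation),
      (∃ Y hY, ReadsCReading C ε Y hY) ∧ ∀ Y hY, ReadsCReading C ε Y hY → ReadsCGalois C ε Y hY) :
    StubE6 :=
  stub_E6_of_readsC fun F _ _ _ _ ι₁ Jstar hJ hJu K₀ S Kc Fi _ _ _ _ τE hτE Φ hΦ C ε hε hU => by
    obtain ⟨⟨Y, hY, hR⟩, hG⟩ := h F ι₁ Jstar hJ hJu K₀ S Kc Fi τE hτE Φ hΦ C ε hε hU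
    exact ⟨Y, hY, readsC_of_galois_of_reading C ε Y hY (hG Y hY hR) hR⟩

/-! ## §3 (v9 = LEAF ED. 1 candidate, A-p06 (g34)) THE HEAD OVER THE DEFS MODULE: `hJ` := the ED. 5 FIELD `C.junction`, Σ-AN BY NAME (★ p848496) — ONE socket `hGAL` (Σ-GAL) -/

/-- **`stub_E6` FROM Σ-GAL ALONE** (v9): in every letter context over the Defs module (D), the (U3) junction is now the `AuxChartGS` FIELD `C.junction` (ED. 5), the
Σ-AN family is ★ `Theorems.F0P6aReadsCReadingOfJunction.readsCReading_of_junction` (A-p06 (g33), p848496; chart fields by value, `iFi := τE.toAlgebra`,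
`Mρ_linear := (C.Mρ_kottwitz …).1`), and the ONE remaining input is Σ-GAL `hGAL : ∀ctx, ∀ Y hY, ReadsCReading C ε Y hY → ReadsCGalois C ε Y hY`
(A-p04 (g24) Σ-GAL skeleton v2 0ee37645, `sigmaGAL_of_stub` over `stub_KCM`, PAID cert LA6-p01 (g0) f1578ce1).  SORRY-FREE composition over `stub_E6_of_sigmaAN_sigmaGAL`.
[cite: Kottwitz1992, §5 (pp. 389–391)] [cite: Milne2005ShimuraVarieties, §13 Prop. 13.1 p. 117 and §6 Thm. 6.11 p. 74] [cite: Shimura1963AnalyticFamilies, §2] -/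
theorem stub_E6_of_sigmaGAL
    (hGAL : ∀ (F : Type) [Field F] [NumberField F] [IsCMField F] [IsGalois ℚ F] (ι₁ : F →+* ℂ)
      (Jstar : Matrix (Fin 2) (Fin 2) F) (_hJ : (Jstar.map (IsCMField.complexConj F))ᵀ = Jstar) (_hJu : IsUnit Jstar)
      (K₀ : C5.OpenCompactSubgroup (GSAdele F Jstar)) (S : RecordSystemGS F Jstar ι₁ K₀) (Kc : C5.SmallLevel K₀)
      (Fi : Type) [Field Fi] [NumberField Fi] [Algebra F Fi] [IsGalois F Fi] (τE : Fi →+* ℂ) (_hτE : τE.comp (algebraMap F Fi) = ι₁)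
      (Φ : Set (F →+* ℂ)) (_hΦ : IsCMTypeThrough ι₁ Φ) (C : AuxChartGS F ι₁ Jstar K₀ S Kc Fi τE Φ)
      (ε : (Literature.AlgebraicGeometry.Motives.baseChange F Fi).obj (S.M.obj Kc) ⟶
          (Literature.AlgebraicGeometry.Motives.baseChange ℚ Fi).obj C.𝓜.M)
      (_hε : letI : Algebra Fi ℂ := τE.toAlgebra
        ∀ (P : ComplexPoints ((Literature.AlgebraicGeometry.Motives.baseChange F Fi).obj (S.M.obj Kc)))
          (Pflat : letI : Algebra F ℂ := ι₁.toAlgebra; ComplexPoints (S.M.obj Kc)),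
          Pflat.left = P.left ≫ pullback.fst (S.M.obj Kc).hom (bcSpec F Fi) →
          (AlgPoints.map ε P).left ≫ pullback.fst C.𝓜.M.hom (bcSpec ℚ Fi) =
            (letI : Algebra F ℂ := ι₁.toAlgebra; (C.f (S.pts Kc Pflat)).left))
      (_hU : Literature.AlgebraicGeometry.ModuliOfAbelianVarieties.siegelUniversalFamilyUniformisation),
      ∀ Y hY, ReadsCReading C ε Y hY → ReadsCGalois C ε Y hY) :
    StubE6 :=
  stub_E6_of_sigmaAN_sigmaGAL fun F _ _ _ _ ι₁ Jstar hJ' hJu K₀ S Kc Fi _ _ _ _ τE hτE Φ hΦ C ε hε hU => by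
    refine ⟨?_, hGAL F ι₁ Jstar hJ' hJu K₀ S Kc Fi τE hτE Φ hΦ C ε hε hU⟩
    haveI := C.smooth_M
    obtain ⟨Y, hY, h⟩ :=
      Summit.HodgeConjecture.HodgeConjecture.Theorems.F0P6aReadsCReadingOfJunction.readsCReading_of_junction (iFi := τE.toAlgebra) S Kc hτE
        C.hg C.hδ C.hN C.𝓜 C.quasiProjective_M C.Sc C.ιc C.isColimit_ιc.some C.unif C.unif_cont C.unif_open C.unif_surj C.unif_iff C.unif_hol
        C.f C.piece C.Z C.u C.rep C.rep_spec C.Z_hol C.Z_mem C.f_mk C.Mρ (fun a v hv b => (C.Mρ_kottwitz a v hv b).imp fun _ h => h.1)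
        C.Z_equivariant C.junction ε hε hU
    exact ⟨Y, hY, h⟩

/-! ## §4 (v10 = LEAF ED. 1 candidate v2, A-p06 (g34)) THE CLOSED HEAD: Σ-GAL BY NAME -/

/-- **`stub_E6` — CLOSED.**  The one input of `stub_E6_of_sigmaGAL` is the Σ-GAL leaf՚s `F0P6aSigmaGAL.sigmaGAL_of_stub` (A-p04 (g24) v3: rigidity ★ B-γ over one CM
point per connected component ★ H0, the CM kernel inputs `stub_KCM` PAID by LA6-p01 (g0) over ★ ONE-CALL `F0P6aCMHomKernelShape`), whose `ReadsCReading` ∕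
`ReadsCGalois` are the very constants this leaf opens — so the application is syntactic.  `StubE6` = the registered socket՚s statement token for token; the E-line
ED. 6 sets `stub_E6 := F0P6aStubE6.stub_E6_of_line`.  SORRY-FREE; axioms TRIO. [cite: Kottwitz1992, §5 (pp. 389–391)]
[cite: Milne2005ShimuraVarieties, §13 Prop. 13.1 p. 117, §14 Prop. 14.12 p. 125 and §6 Thm. 6.11 p. 74] [cite: Shimura1963AnalyticFamilies, §2] -/
theorem stub_E6_of_line : StubE6 :=
  stub_E6_of_sigmaGAL sigmaGAL_of_stub

end Summit.HodgeConjecture.HodgeConjecture.Cruxes.HLiu418.F0P6aStubE6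

end
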